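import Summits.HubbardSuperconductivity.HubbardSuperconductivity.Theses.ThermalWedge
import Summits.HubbardSuperconductivity.HubbardSuperconductivity.Theorems.ThermalWedgeTwSeededEnsembleEquivalenceROptimiserFloor
import Summits.HubbardSuperconductivity.HubbardSuperconductivity.Theorems.ThermalWedgeTwSeededEnsembleEquivalenceRColdSlice
import Summits.HubbardSuperconductivity.HubbardSuperconductivity.Theorems.ThermalWedgeTwSeededEnsembleEquivalenceRNoSplitGlue
import Summits.HubbardSuperconductivity.HubbardSuperconductivity.Theorems.ThermalWedgeTwSeededEnsembleEquivalenceRColdEdgeSweep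
import Summits.HubbardSuperconductivity.HubbardSuperconductivity.Theorems.ThermalWedgeTwSeededEnsembleEquivalenceRColdSlicePackaging
import Summits.HubbardSuperconductivity.HubbardSuperconductivity.Theorems.ThermalWedgeTwSeededEnsembleEquivalenceRTwoPhaseCore

/-!
# Crux `TwSeededEnsembleEquivalenceR` (stmt-HubbardSuperconductivity-15581), line `cold-floor-collapse` (slug `Sketch`), lead c10:
# THE REDUCTION THEOREM of skeleton v8.5 — R from condensation (stmt-1697) and DEEP-UNIQ′ (block two-phase pinning; DEEP-DIFF eliminated)

Support file (`--supports stmt-HubbardSuperconductivity-15581`; sorry-free; no definition). The line `Sketch` proves the crux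
`TwSeededEnsembleEquivalenceR` (sourced/seeded ensemble equivalence of the d-wave Hubbard torus at the cold slice `β = e^{a/U}`)
from the route item `TwSourcedCondensation` (stmt-HubbardSuperconductivity-1697, hypothesis `hC` of the deciding theorem
`closes`) and ONE physics statement, DEEP-UNIQ′ (the registered stub `stub_sourcedColdUniqDeep`: on every compact window of
chemical potentials, for small exponents `a` and the seed floor `K'(a)`, the maximisers `h` of `h ↦ q(μ,h) − h²/g` over the
source box with `e^{−a/(4U)} ≤ |h|` have a unique modulus). This file turns the v8.5 skeleton into a kernel-checked
theorem with DEEP-UNIQ′ as an explicit hypothesis; everything else is landed: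

* cold slice `twR_iff_coldSlice` (…RColdSlice);
* packaging `stub_coldSlicePackaging` (…RColdSlicePackaging, p141162): EDGE-sweep + NoSplit + the finite-volume two-phase bound +
  the sharp probabilistic normal form;
* EDGE-sweep `stub_coldEdgeSweep` (…RColdEdgeSweep, p141703);
* NoSplit `stub_noSplitGlue` (…RNoSplitGlue, p140485) from FLOOR `stub_optimiserFloor hC` (…ROptimiserFloor, p125780) + DEEP-UNIQ′;
* the finite-volume block two-phase bound `stub_twoPhaseCore` (…RTwoPhaseCore, p144901; assembly of the sector calculus
  …RSeededSectorCalculus p143256, the trial-state budget …RTrialStateBudget p144269 and the optimised penalty …RSelectionTransfer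
  p141200, themselves built on …RPbSectorSelection, …RSectorWeightLipschitz, …RBlockProduct, …RLogPartitionCalculus,
  …RBlockPressureLimit, …RTrialMoments, …RBlockDensityCalculus, …RTwoPhaseBudgetArithmetic and `twApproximatingHamiltonian_proof`).

No μ-differentiability of any pressure is used (DEEP-DIFF of v5–v7 is gone).
-/

set_option linter.dupNamespace false

namespace Summit.HubbardSuperconductivity.HubbardSuperconductivity.Theorems.TwSeededEnsembleEquivalenceR.ColdFloorLine

open Matrix Filter Topology Finset Literature.MathematicalPhysics.QuantumLattice
open Literature.Barriers.HubbardSuperconductivity Literature.Probability.LatticeModels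
open Summit.HubbardSuperconductivity.HubbardSuperconductivity.Theses.ThermalWedge
open Summit.HubbardSuperconductivity.HubbardSuperconductivity.Theorems.TwSeededEnsembleEquivalenceR.ColdFloor
open scoped ComplexOrder Matrix.Norms.L2Operator

noncomputable section

/-- **The crux from condensation and DEEP-UNIQ′ (line `Sketch`, skeleton v8.5 made into a theorem).** `TwSeededEnsembleEquivalenceR`
follows from the route item `TwSourcedCondensation` (stmt-HubbardSuperconductivity-1697, hypothesis `hC` of `closes`) and the ONE
remaining physics statement DEEP-UNIQ′ (uniqueness of the optimal source modulus among deep maximisers at the cold slice, small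
exponents — the registered stub `stub_sourcedColdUniqDeep`, here an explicit hypothesis): cold slice (`twR_iff_coldSlice`) ⟸ packaging
(`stub_coldSlicePackaging`) of EDGE-sweep (`stub_coldEdgeSweep`), NoSplit (`stub_noSplitGlue` from FLOOR `stub_optimiserFloor hC` + DEEP-UNIQ′)
and the finite-volume block two-phase bound (`stub_twoPhaseCore`). DEEP-DIFF is not used. [folklore composition] -/
theorem stub_twR_of_condensation_of_deepUniq :
    TwSourcedCondensation →
    (∀ (μ₁ μ₂ : ℝ), -4 < μ₁ → μ₁ < μ₂ → μ₂ < 0 → ∃ a₁ : ℝ, 0 < a₁ ∧ ∀ a ∈ Set.Ioc (0 : ℝ) a₁,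
      ∃ K' U₀ : ℝ, 0 < K' ∧ 0 < U₀ ∧ ∀ U ∈ Set.Ioc (0 : ℝ) U₀, ∀ g ∈ Set.Icc (K' * U) (1 / 10),
        ∀ q : ℝ → ℝ → ℝ,
          (∀ μ ∈ Set.Icc μ₁ μ₂, ∀ h ∈ Set.Icc (-(13 * g + 1)) (13 * g + 1), ∀ κ : ℝ, 0 < κ →
            ∃ L₀ : ℕ, ∀ (L : ℕ) [NeZero L], L₀ ≤ L →
              |Real.log (Matrix.partitionFn (Real.exp (a / U)) (dWaveSourceTorus L U μ h)).re /
                  (Real.exp (a / U) * (L : ℝ) ^ 2) - q μ h| ≤ κ) →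
          ∀ μ ∈ Set.Ioo μ₁ μ₂, ∃ hstar : ℝ, ∀ h ∈ Set.Icc (-(13 * g + 1)) (13 * g + 1),
            Real.exp (-(a / (4 * U))) ≤ |h| →
            q μ h - h ^ 2 / g = sSup ((fun h' : ℝ => q μ h' - h' ^ 2 / g) '' Set.Icc (-(13 * g + 1)) (13 * g + 1)) →
              h = hstar ∨ h = -hstar) →
    TwSeededEnsembleEquivalenceR :=
  fun hC hU => twR_iff_coldSlice.mpr
    (stub_coldSlicePackaging stub_coldEdgeSweep (stub_noSplitGlue (stub_optimiserFloor hC) hU) stub_twoPhaseCore)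

end

end Summit.HubbardSuperconductivity.HubbardSuperconductivity.Theorems.TwSeededEnsembleEquivalenceR.ColdFloorLine
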